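import Summits.QuantumFields.BalabanUV.Beta.GAN24.CoarseGaugeSourceResponse
import Summits.QuantumFields.BalabanUV.Beta.GAN24.CubicPushFaceCharge
import Summits.QuantumFields.BalabanUV.Beta.GAN24.CombKernelSheetResponse

/-!
# `BalabanUV.Beta.GAN24.ChargeTowerLegs` — binder row G-an2-4 ∕ (CONV-C), the (S) row ∕ (W-γ) AT EVERY LEVEL («the Δ_j-exact charge tower», road-P2 gen 41, memo
# `HOME/b2b-balaban-gan24-p2/gen41/W-GAMMA-TOWER-v0.md`, step (I1)∘(I2), THE LEGS): **THE TWO-KERNEL SANDWICH FUBINI AND THE FOUR WEIGHTED COARSE-LEG CHARGES OF THE CO-DRESSED STEP RESOLVENT** against bounded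
# single-coordinate weights (every level `j`, in-block root) — the legs of the tower step `GAN24/ChargeTowerStep`

NOT IN PRINT; OUR BOOKKEEPING ([folklore]: §1 is my g35 `SandwichReadoutSiteDep.hasSum_sandwich_readout_dep` with TWO kernels (left∕right) — proof verbatim, constants `C₁, C₂`; §2 packages
my g41 `CoarseGaugeSourceResponse.tsum_coord_colH ∕ tsum_coord_colM` + leaf-02∕an4's row antisymmetry `CombKernelSheetResponse.coDressKBmAt_KInvStep_inr_inl_eq_neg_colH` + an1's
response-slot multiplier Ward law `KernelWardMColumn.colM_coDressKBmAt_KInvStep_ward_resp` + gan24-leaf-14's `MultiplierZeroMass` off-lattice zeros as the four WEIGHTED coarse-leg charges of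
`G_j`; §3 is leaf-02 g52's `CubicPushFaceCharge` §1–§3 with the weights carried; 0 `def`, 0 cited fact, 0 `def … : Prop`, 0 sorry).  HONEST FRAMING (cell contract, verbatim): «discharging
`BetaPertH` makes Bałaban's UV stability UNCONDITIONAL — a real constructive-QFT result; it is NOT the continuum limit and NOT the Clay problem.»  HONEST DEPENDENCY (verbatim): «continuum YM
on T⁴ ⇐ BetaPertH ∧ nine spine estimates (0/9 proved); BetaPertH ⇐ (D1) ∧ (D4) ∧ CAP+tail; G-an2-4 gates asym, D1 and NE2/3/4.»

* §1 `summable_legs_prod₂`, **`hasSum_sandwich_readout_two`** (the sandwich Fubini `Σ'_{(x′,z′)} (K₁ ∘ V ∘ K₂)(N•x′, N•z′)_{(inr α, inr β)} = Σ'_{(y,w)} Σ_{f,g} ρL f y·V y w f g·ρR g w` for two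
  decaying kernels with site-dependent coarse-leg charges `ρL` (rows of `K₁`) ∕ `ρR` (columns of `K₂`), `V` bi-localised).
* §2 THE WEIGHTED COARSE-LEG CHARGES OF `G_j = coDressKBmAt ρ Lc (KInvStep Lc j)` against a bounded single-coordinate weight `f(·_α)` on the coarse index (every `j`, in-block root;
  `cH_j = (stepScale_j·Lc^{d+1})⁻¹`): rows `hasSum_row_coord_inl` (`Σ'_{x′} f(x′_α)·G_j (Lc•x′) y (inr α)(inl κ) = −cH_j·𝟙[κ = α ∧ y_α % Lc = Lc−1]·f((blk y)_α)`), `hasSum_row_coord_inr` (`= 0`),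
  columns `hasSum_col_coord_inl` (`+cH_j·…`), `hasSum_col_coord_inr` (`= 0`); the response-slot twins `tsum_coordGrad_colM_resp` ∕ `tsum_coord_colM_resp` of my g41 source-slot laws.
* (§3–§4 — the tower step itself and the vertex-unfolding Fubini — are the sequel file `GAN24/ChargeTowerStep.lean`, split off for the 400-line rule.)
READING.  With road-P2's E28 (kit j166124∕j166535): the charge functions of `SrecAt j` against exit-supported block-constant weights are `Δ_j`-exact up to per-direction constants (slot-
divergence-free to 1e-15 at jb = 0; jb = 1 in the memo), so by leaf-06's Ward pairing at level `j` and `(G_j)_{mm} = E2_{j+1}` the right side above is `Δ_{j+1}`-exact again — the induction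
«(I3)_j ⇒ (I3)_{j+1}» runs through THIS identity.  Asserts NO value of Bałaban's tables; discharges NOTHING of (W-γ) ∕ (INV) ∕ (S) ∕ (Q-R) ∕ (LT) ∕ (Q-L) ∕ (C) ∕ «T2Shape» ∕ «T2Drift» ∕ (hW, hWall);
NEVER «G-an2-4 closed» as (CONV-C); NOT D1, NOT `BetaPertH`, NOT continuum, NOT Clay.  2026-08-22; no existing file touched.
-/

noncomputable section

open Finset
open scoped BigOperators
open Literature.MathematicalPhysics.QuantumFieldTheory
open Literature.MathematicalPhysics.QuantumFieldTheory.Balaban1983to89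
open Literature.MathematicalPhysics.QuantumFieldTheory.Balaban1983to89.Beta
open Literature.Probability.LatticeModels (Torus.proj)
open LatticeForm (quo)
open B12Sec2to5 (l1 l1_nonneg summable_exp_neg_l1)
open B6BondElimination (unitVec unitVec_apply)
open ExpKernelCalculus (Site MKer BiLoc Decays comp l1_natSmul l1_sub_triangle l1_sub_symm Zl Zl_nonneg summable_exp_shift summable_exp_shift' tsum_exp_shift tsum_exp_shift')
open OneStepResolventKernel (Fib LocStencil eq_zsmul_quo_of_proj)
open AffineAveraging (box toSite)
open AveragingContours (blk)
open AxialProjector (blk_zsmul)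
open OneStepKernelFamily (KInvStep colH vertexOfK vertexFamily_vertexOfK decays_KInvStep KInvStep_inr_off)
open SecondOrderResponse (colM)
open BalabanStepJetsSucc (mmRead mmRead_inl_inl wE wVH)
open BalabanStepJets (locStencil_mono)
open AveragingHessianKernelsRooted (vhSAt)
open Summit.QuantumFields.BalabanUV.Beta.AxialDressingRooted (coDressKBmAt coDressKBmAt_inr_inr decays_coDressKBmAt)
open Summit.QuantumFields.BalabanUV.Beta.BorderedHessian (stepScale)
open Summit.QuantumFields.BalabanUV.Beta.SpineRooted (e3OfK e3OfK_apply SpureRecAt SpureRecAt_succ)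
open Summit.QuantumFields.BalabanUV.Beta.WardLocusRecursive (SrecAt locStencil_SrecAt)
open Summit.QuantumFields.BalabanUV.Beta.KernelWardMColumn (colM_coDressKBmAt colM_coDressKBmAt_KInvStep_ward_resp)
open Summit.QuantumFields.BalabanUV.Beta.GAN24.KernelLegCharges (summable_exp_coarse)
open Summit.QuantumFields.BalabanUV.Beta.GAN24.ResolventLegCharges (summable_exp_coarse' tsum_exp_coarse_le tsum_exp_coarse_le')
open Summit.QuantumFields.BalabanUV.Beta.GAN24.MultiplierZeroMass (hasSum_KInvStep_mm_left KInvStep_inr_inr_off_right)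
open Summit.QuantumFields.BalabanUV.Beta.GAN24.CombKernelSheetResponse (coDressKBmAt_KInvStep_inr_inl_eq_neg_colH)
open Summit.QuantumFields.BalabanUV.Beta.GAN24.CubicPushFaceCharge (vhSAt_inl_inl)
open Summit.QuantumFields.BalabanUV.Beta.GAN24.CoarseGaugeSourceResponse (summable_bdd_mul tsum_mul_coarseDiv_eq tsum_coord_fibre summable_source_colH summable_source_colM
  tsum_coord_colH tsum_coord_colM)

namespace Summit.QuantumFields.BalabanUV.Beta.GAN24.ChargeTowerLegs

variable {d : ℕ} {N : ℕ}

/-! ## §1 The sandwich read-out Fubini with two kernels -/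

/-- [folklore] Product summability of the two coarse legs `(x′, z′) ↦ K₁ (N•x′) y a f · K₂ w (N•z′) g b` of two decaying kernels (same rate). -/
theorem summable_legs_prod₂ [NeZero N] {K₁ K₂ : MKer (d + 1) (Fib d)} {C₁ C₂ δ : ℝ} (hK₁ : Decays K₁ C₁ δ) (hK₂ : Decays K₂ C₂ δ) (hδ : 0 < δ)
    (y w : Site (d + 1)) (a b f g : Fib d) :
    Summable fun xz : Site (d + 1) × Site (d + 1) => K₁ ((N : ℤ) • xz.1) y a f * K₂ w ((N : ℤ) • xz.2) g b := by
  have hN : 1 ≤ N := Nat.one_le_iff_ne_zero.2 (NeZero.ne N)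
  have hC₁ : 0 ≤ C₁ := hK₁.nonneg a
  have h1 := summable_exp_coarse (d := d) hN hδ y
  have h2 := summable_exp_coarse' (d := d) hN hδ w
  have hprod := ((h1.mul_of_nonneg h2 (fun _ => (Real.exp_pos _).le) (fun _ => (Real.exp_pos _).le)).mul_left (C₁ * C₂))
  refine Summable.of_norm_bounded hprod (fun xz => ?_)
  rw [Real.norm_eq_abs, abs_mul]
  have e1 := hK₁ ((N : ℤ) • xz.1) y a f
  have e2 := hK₂ w ((N : ℤ) • xz.2) g b
  calc |K₁ ((N : ℤ) • xz.1) y a f| * |K₂ w ((N : ℤ) • xz.2) g b|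
      ≤ (C₁ * Real.exp (-δ * l1 ((N : ℤ) • xz.1 - y))) * (C₂ * Real.exp (-δ * l1 (w - (N : ℤ) • xz.2))) :=
        mul_le_mul e1 e2 (abs_nonneg _) ((abs_nonneg _).trans e1)
    _ = _ := by ring

/-- [folklore] **THE SANDWICH READ-OUT FUBINI WITH TWO KERNELS** (left `K₁`, right `K₂`, both decaying at rate `δ`; site-dependent coarse-leg charges `ρL` of the ROWS of `K₁` against `inr α`,
`ρR` of the COLUMNS of `K₂` against `inr β`; `V` bi-localised): the `mm`-entries of `K₁ ∘ V ∘ K₂` at the coarse points have the double-leg `HasSum` `Σ'_{(y,w)} Σ_{f,g} ρL f y·V y w f g·ρR g w`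
(my g35 `hasSum_sandwich_readout_dep` is `K₁ = K₂`; proof verbatim). -/
theorem hasSum_sandwich_readout_two [NeZero N] {K₁ K₂ V : MKer (d + 1) (Fib d)} {C₁ C₂ δ Cv δv : ℝ} {p q : Site (d + 1)} (hK₁ : Decays K₁ C₁ δ) (hK₂ : Decays K₂ C₂ δ) (hδ : 0 < δ)
    (hV : BiLoc V p q Cv δv) (hδv : 0 < δv) (α β : Fin (d + 1)) {ρL ρR : Fib d → Site (d + 1) → ℝ}
    (hrow : ∀ f y, HasSum (fun x' : Site (d + 1) => K₁ ((N : ℤ) • x') y (Sum.inr α) f) (ρL f y))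
    (hcol : ∀ g w, HasSum (fun z' : Site (d + 1) => K₂ w ((N : ℤ) • z') g (Sum.inr β)) (ρR g w)) :
    HasSum (fun xz : Site (d + 1) × Site (d + 1) => comp (comp K₁ V) K₂ ((N : ℤ) • xz.1) ((N : ℤ) • xz.2) (Sum.inr α) (Sum.inr β))
      (∑' yw : Site (d + 1) × Site (d + 1), ∑ f, ∑ g, ρL f yw.1 * V yw.1 yw.2 f g * ρR g yw.2) := by
  classical
  have hN : 1 ≤ N := Nat.one_le_iff_ne_zero.2 (NeZero.ne N)
  have hC₁ : 0 ≤ C₁ := hK₁.nonneg (Sum.inl 0)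
  have hC₂ : 0 ≤ C₂ := hK₂.nonneg (Sum.inl 0)
  have hCv : 0 ≤ Cv := hV.nonneg (Sum.inl 0)
  set cF : ℝ := ((Fintype.card (Fib d) : ℕ) : ℝ) with hcF
  -- the four-leg family, outer index `(y, w)`, inner index `(x′, z′)`
  set Φ : Site (d + 1) × Site (d + 1) → Site (d + 1) × Site (d + 1) → ℝ := fun yw xz =>
    ∑ f, ∑ g, K₁ ((N : ℤ) • xz.1) yw.1 (Sum.inr α) f * V yw.1 yw.2 f g * K₂ yw.2 ((N : ℤ) • xz.2) g (Sum.inr β) with hΦ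
  -- the majorant and its sums
  set U : ℝ := Real.exp (δ * ((N : ℝ) * (d + 1))) * Zl (d + 1) δ with hU
  set M : Site (d + 1) × Site (d + 1) → Site (d + 1) × Site (d + 1) → ℝ := fun yw xz =>
    (cF * cF * (C₁ * Cv * C₂) * Real.exp (-δv * (l1 (yw.1 - p) + l1 (yw.2 - q)))) *
      (Real.exp (-δ * l1 ((N : ℤ) • xz.1 - yw.1)) * Real.exp (-δ * l1 (yw.2 - (N : ℤ) • xz.2))) with hM
  have hM0 : ∀ yw xz, 0 ≤ M yw xz := fun yw xz => by positivity
  have hΦM : ∀ yw xz, |Φ yw xz| ≤ M yw xz := by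
    intro yw xz
    have hterm : ∀ f g, |K₁ ((N : ℤ) • xz.1) yw.1 (Sum.inr α) f * V yw.1 yw.2 f g * K₂ yw.2 ((N : ℤ) • xz.2) g (Sum.inr β)| ≤
        (C₁ * Real.exp (-δ * l1 ((N : ℤ) • xz.1 - yw.1))) * (Cv * Real.exp (-δv * (l1 (yw.1 - p) + l1 (yw.2 - q)))) *
          (C₂ * Real.exp (-δ * l1 (yw.2 - (N : ℤ) • xz.2))) := by
      intro f g
      rw [abs_mul, abs_mul]
      have e1 := hK₁ ((N : ℤ) • xz.1) yw.1 (Sum.inr α) f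
      have e2 := hV yw.1 yw.2 f g
      have e3 := hK₂ yw.2 ((N : ℤ) • xz.2) g (Sum.inr β)
      exact mul_le_mul (mul_le_mul e1 e2 (abs_nonneg _) ((abs_nonneg _).trans e1)) e3 (abs_nonneg _)
        (mul_nonneg ((abs_nonneg _).trans e1) ((abs_nonneg _).trans e2))
    calc |Φ yw xz| ≤ ∑ f, ∑ g, |K₁ ((N : ℤ) • xz.1) yw.1 (Sum.inr α) f * V yw.1 yw.2 f g * K₂ yw.2 ((N : ℤ) • xz.2) g (Sum.inr β)| :=
          (Finset.abs_sum_le_sum_abs _ _).trans (Finset.sum_le_sum fun f _ => Finset.abs_sum_le_sum_abs _ _)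
      _ ≤ ∑ _f : Fib d, ∑ _g : Fib d, (C₁ * Real.exp (-δ * l1 ((N : ℤ) • xz.1 - yw.1))) *
            (Cv * Real.exp (-δv * (l1 (yw.1 - p) + l1 (yw.2 - q)))) * (C₂ * Real.exp (-δ * l1 (yw.2 - (N : ℤ) • xz.2))) :=
          Finset.sum_le_sum fun f _ => Finset.sum_le_sum fun g _ => hterm f g
      _ = M yw xz := by
          simp only [Finset.sum_const, Finset.card_univ, nsmul_eq_mul, hM, hcF]
          ring
  -- inner sums of the majorant
  have hMin : ∀ yw, HasSum (fun xz => M yw xz)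
      ((cF * cF * (C₁ * Cv * C₂) * Real.exp (-δv * (l1 (yw.1 - p) + l1 (yw.2 - q)))) *
        ((∑' x' : Site (d + 1), Real.exp (-δ * l1 ((N : ℤ) • x' - yw.1))) *
          ∑' z' : Site (d + 1), Real.exp (-δ * l1 (yw.2 - (N : ℤ) • z')))) := by
    intro yw
    have h1 := summable_exp_coarse (d := d) hN hδ yw.1
    have h2 := summable_exp_coarse' (d := d) hN hδ yw.2
    have h12 := h1.hasSum.mul h2.hasSum (h1.mul_of_nonneg h2 (fun _ => (Real.exp_pos _).le) (fun _ => (Real.exp_pos _).le))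
    exact h12.mul_left _
  have hMs : Summable (Function.uncurry M) := by
    refine (summable_prod_of_nonneg (fun s => hM0 s.1 s.2)).2 ⟨fun yw => (hMin yw).summable, ?_⟩
    have hbound : ∀ yw : Site (d + 1) × Site (d + 1), ∑' xz, M yw xz ≤
        (cF * cF * (C₁ * Cv * C₂) * (U * U)) * (Real.exp (-δv * l1 (yw.1 - p)) * Real.exp (-δv * l1 (yw.2 - q))) := by
      intro yw
      rw [(hMin yw).tsum_eq, mul_add, Real.exp_add]
      have hA := tsum_exp_coarse_le (d := d) N hδ yw.1
      have hB := tsum_exp_coarse_le' (d := d) N hδ yw.2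
      have hA0 : 0 ≤ ∑' x' : Site (d + 1), Real.exp (-δ * l1 ((N : ℤ) • x' - yw.1)) := tsum_nonneg fun _ => (Real.exp_pos _).le
      have hB0 : 0 ≤ ∑' z' : Site (d + 1), Real.exp (-δ * l1 (yw.2 - (N : ℤ) • z')) := tsum_nonneg fun _ => (Real.exp_pos _).le
      have hU0 : 0 ≤ U := mul_nonneg (Real.exp_pos _).le (Zl_nonneg hδ)
      have hAB := mul_le_mul hA hB hB0 hU0
      have hc0 : 0 ≤ cF * cF * (C₁ * Cv * C₂) * (Real.exp (-δv * l1 (yw.1 - p)) * Real.exp (-δv * l1 (yw.2 - q))) := by positivity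
      calc cF * cF * (C₁ * Cv * C₂) * (Real.exp (-δv * l1 (yw.1 - p)) * Real.exp (-δv * l1 (yw.2 - q))) *
            ((∑' x' : Site (d + 1), Real.exp (-δ * l1 ((N : ℤ) • x' - yw.1))) * ∑' z' : Site (d + 1), Real.exp (-δ * l1 (yw.2 - (N : ℤ) • z')))
          ≤ cF * cF * (C₁ * Cv * C₂) * (Real.exp (-δv * l1 (yw.1 - p)) * Real.exp (-δv * l1 (yw.2 - q))) * (U * U) :=
            mul_le_mul_of_nonneg_left hAB hc0
        _ = _ := by ring
    have hsum : Summable fun yw : Site (d + 1) × Site (d + 1) =>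
        (cF * cF * (C₁ * Cv * C₂) * (U * U)) * (Real.exp (-δv * l1 (yw.1 - p)) * Real.exp (-δv * l1 (yw.2 - q))) :=
      ((summable_exp_shift' hδv p).mul_of_nonneg (summable_exp_shift' hδv q) (fun _ => (Real.exp_pos _).le)
        (fun _ => (Real.exp_pos _).le)).mul_left _
    exact Summable.of_nonneg_of_le (fun yw => tsum_nonneg fun xz => hM0 yw xz) hbound hsum
  -- (A) absolute summability of the four-leg family
  have hΦs : Summable (Function.uncurry Φ) :=
    Summable.of_norm_bounded hMs (fun s => by rw [Real.norm_eq_abs]; exact hΦM s.1 s.2)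
  -- (C) the inner sums: only the charges survive
  have hΦin : ∀ yw : Site (d + 1) × Site (d + 1), HasSum (fun xz => Φ yw xz) (∑ f, ∑ g, ρL f yw.1 * V yw.1 yw.2 f g * ρR g yw.2) := by
    intro yw
    refine hasSum_sum fun f _ => hasSum_sum fun g _ => ?_
    have hmul := ((hrow f yw.1).mul (hcol g yw.2) (summable_legs_prod₂ hK₁ hK₂ hδ yw.1 yw.2 _ _ f g)).mul_left (V yw.1 yw.2 f g)
    rw [show V yw.1 yw.2 f g * (ρL f yw.1 * ρR g yw.2) = ρL f yw.1 * V yw.1 yw.2 f g * ρR g yw.2 by ring] at hmul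
    exact hmul.congr_fun fun xz => by ring
  -- (B) the pointwise identity: the nested composition IS the `(y, w)`-sum of `Φ`
  have hΦyw : ∀ xz : Site (d + 1) × Site (d + 1), Summable fun yw : Site (d + 1) × Site (d + 1) => Φ yw xz :=
    fun xz => hΦs.prod_symm.prod_factor xz
  have hpoint : ∀ xz : Site (d + 1) × Site (d + 1),
      comp (comp K₁ V) K₂ ((N : ℤ) • xz.1) ((N : ℤ) • xz.2) (Sum.inr α) (Sum.inr β) = ∑' yw : Site (d + 1) × Site (d + 1), Φ yw xz := by
    intro xz
    -- summability of the `(w, y)`-ordered family and of its `y`-slices with one fibre index fixed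
    have hwy : Summable fun wy : Site (d + 1) × Site (d + 1) => Φ (wy.2, wy.1) xz :=
      (Equiv.prodComm (Site (d + 1)) (Site (d + 1))).summable_iff.2 (hΦyw xz) |>.congr fun wy => rfl
    have hslice : ∀ (w : Site (d + 1)) (g : Fib d), Summable fun y : Site (d + 1) =>
        ∑ f, K₁ ((N : ℤ) • xz.1) y (Sum.inr α) f * V y w f g * K₂ w ((N : ℤ) • xz.2) g (Sum.inr β) := by
      intro w g
      have hmaj : Summable fun y : Site (d + 1) => (cF * (C₁ * Cv * (C₂ * Real.exp (-δ * l1 (w - (N : ℤ) • xz.2))))) *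
          Real.exp (-δ * l1 ((N : ℤ) • xz.1 - y)) := (summable_exp_shift hδ _).mul_left _
      refine Summable.of_norm_bounded hmaj (fun y => ?_)
      rw [Real.norm_eq_abs]
      have hterm : ∀ f, |K₁ ((N : ℤ) • xz.1) y (Sum.inr α) f * V y w f g * K₂ w ((N : ℤ) • xz.2) g (Sum.inr β)| ≤
          (C₁ * Real.exp (-δ * l1 ((N : ℤ) • xz.1 - y))) * Cv * (C₂ * Real.exp (-δ * l1 (w - (N : ℤ) • xz.2))) := by
        intro f
        rw [abs_mul, abs_mul]
        have e1 := hK₁ ((N : ℤ) • xz.1) y (Sum.inr α) f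
        have e2 : |V y w f g| ≤ Cv := by
          refine (hV y w f g).trans ?_
          have : Real.exp (-δv * (l1 (y - p) + l1 (w - q))) ≤ 1 :=
            Real.exp_le_one_iff.2 (by nlinarith [l1_nonneg (y - p), l1_nonneg (w - q)])
          nlinarith
        have e3 := hK₂ w ((N : ℤ) • xz.2) g (Sum.inr β)
        exact mul_le_mul (mul_le_mul e1 e2 (abs_nonneg _) ((abs_nonneg _).trans e1)) e3 (abs_nonneg _)
          (mul_nonneg ((abs_nonneg _).trans e1) ((abs_nonneg _).trans e2))
      calc |∑ f, K₁ ((N : ℤ) • xz.1) y (Sum.inr α) f * V y w f g * K₂ w ((N : ℤ) • xz.2) g (Sum.inr β)|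
          ≤ ∑ f, |K₁ ((N : ℤ) • xz.1) y (Sum.inr α) f * V y w f g * K₂ w ((N : ℤ) • xz.2) g (Sum.inr β)| := Finset.abs_sum_le_sum_abs _ _
        _ ≤ ∑ _f : Fib d, (C₁ * Real.exp (-δ * l1 ((N : ℤ) • xz.1 - y))) * Cv * (C₂ * Real.exp (-δ * l1 (w - (N : ℤ) • xz.2))) :=
            Finset.sum_le_sum fun f _ => hterm f
        _ = _ := by simp only [Finset.sum_const, Finset.card_univ, nsmul_eq_mul, hcF]; ring
    -- rewrite the nested composition
    have hinner : ∀ w : Site (d + 1), ∑ g, comp K₁ V ((N : ℤ) • xz.1) w (Sum.inr α) g * K₂ w ((N : ℤ) • xz.2) g (Sum.inr β)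
        = ∑' y : Site (d + 1), Φ (y, w) xz := by
      intro w
      have e1 : ∀ g, comp K₁ V ((N : ℤ) • xz.1) w (Sum.inr α) g * K₂ w ((N : ℤ) • xz.2) g (Sum.inr β)
          = ∑' y : Site (d + 1), ∑ f, K₁ ((N : ℤ) • xz.1) y (Sum.inr α) f * V y w f g * K₂ w ((N : ℤ) • xz.2) g (Sum.inr β) := by
        intro g
        simp only [comp]
        rw [← tsum_mul_right]
        exact tsum_congr fun y => by rw [Finset.sum_mul]
      simp_rw [e1]
      rw [(Summable.tsum_finsetSum fun g _ => hslice w g).symm]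
      exact tsum_congr fun y => Finset.sum_comm
    calc comp (comp K₁ V) K₂ ((N : ℤ) • xz.1) ((N : ℤ) • xz.2) (Sum.inr α) (Sum.inr β)
        = ∑' w : Site (d + 1), ∑' y : Site (d + 1), Φ (y, w) xz := by
          simp only [comp] at hinner ⊢
          exact tsum_congr fun w => hinner w
      _ = ∑' wy : Site (d + 1) × Site (d + 1), Φ (wy.2, wy.1) xz := (hwy.tsum_prod).symm
      _ = ∑' yw : Site (d + 1) × Site (d + 1), Φ yw xz :=
          (Equiv.prodComm (Site (d + 1)) (Site (d + 1))).tsum_eq (fun yw : Site (d + 1) × Site (d + 1) => Φ yw xz)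
  -- (D) assemble
  have hF : Summable fun xz : Site (d + 1) × Site (d + 1) => ∑' yw : Site (d + 1) × Site (d + 1), Φ yw xz := hΦs.prod_symm.prod
  have hval : ∑' xz : Site (d + 1) × Site (d + 1), ∑' yw : Site (d + 1) × Site (d + 1), Φ yw xz
      = ∑' yw : Site (d + 1) × Site (d + 1), ∑ f, ∑ g, ρL f yw.1 * V yw.1 yw.2 f g * ρR g yw.2 := by
    rw [hΦs.tsum_comm]
    exact tsum_congr fun yw => (hΦin yw).tsum_eq
  have h := hF.hasSum
  rw [hval] at h
  exact h.congr_fun fun xz => hpoint xz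

/-! ## §2 The weighted coarse-leg charges of the co-dressed step resolvent (single-coordinate bounded weights) -/

section Step

variable {Lc : ℕ} [NeZero Lc] {r : Fin (d + 1) → ℕ}

/-- [folklore] The multiplier column of `G_j` is summable in its RESPONSE slot (it is the undressed one; gan24-leaf-14's `hasSum_KInvStep_mm_left`). -/
theorem summable_resp_colM (ρ : Site (d + 1)) (j : ℕ) (μ : Fin (d + 1)) (y : Site (d + 1)) (ρ' : Fin (d + 1)) :
    Summable fun w : Site (d + 1) => colM (coDressKBmAt ρ Lc (KInvStep (d := d) Lc j)) Lc μ y ρ' w := by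
  have e : (fun w : Site (d + 1) => colM (coDressKBmAt ρ Lc (KInvStep (d := d) Lc j)) Lc μ y ρ' w)
      = fun w => KInvStep (d := d) Lc j (((Lc : ℕ) : ℤ) • w) (((Lc : ℕ) : ℤ) • y) (Sum.inr ρ') (Sum.inr μ) := by
    funext w; rw [colM_coDressKBmAt]; rfl
  rw [e]
  exact (hasSum_KInvStep_mm_left (d := d) (Lc := Lc) j ρ' μ (((Lc : ℕ) : ℤ) • y)).summable

/-- NOT IN PRINT; OUR BOOKKEEPING.  **THE COARSE-GRADIENT LAW IN THE RESPONSE SLOT OF THE MULTIPLIER COLUMN**: for bounded `φ`,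
`Σ_ρ′ Σ'_w (φ(w + e_ρ′) − φ(w))·colM G_j Lc μ y ρ′ w = 0` — an1's response-slot Ward law `colM_coDressKBmAt_KInvStep_ward_resp` summed by parts (my g41 `tsum_mul_coarseDiv_eq`). -/
theorem sum_tsum_coarseGrad_colM_resp (ρ : Site (d + 1)) (j : ℕ) (φ : Site (d + 1) → ℝ) {B : ℝ} (hφ : ∀ w, |φ w| ≤ B) (μ : Fin (d + 1)) (y : Site (d + 1)) :
    ∑ ρ', ∑' w : Site (d + 1), (φ (w + unitVec ρ') - φ w) * colM (coDressKBmAt ρ Lc (KInvStep (d := d) Lc j)) Lc μ y ρ' w = 0 := by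
  rw [← tsum_mul_coarseDiv_eq (fun ρ' w => colM (coDressKBmAt ρ Lc (KInvStep (d := d) Lc j)) Lc μ y ρ' w)
    (fun ρ' => summable_resp_colM ρ j μ y ρ') φ hφ]
  have e : ∀ w : Site (d + 1),
      φ w * ∑ ρ', (colM (coDressKBmAt ρ Lc (KInvStep (d := d) Lc j)) Lc μ y ρ' (w - unitVec ρ')
        - colM (coDressKBmAt ρ Lc (KInvStep (d := d) Lc j)) Lc μ y ρ' w) = 0 := fun w => by
    rw [colM_coDressKBmAt_KInvStep_ward_resp ρ j μ y w, mul_zero]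
  rw [tsum_congr e, tsum_zero]

/-- NOT IN PRINT; OUR BOOKKEEPING.  Single-coordinate version in the response slot: `Σ'_w (Φ(w_α+1) − Φ(w_α))·colM G_j Lc μ y α w = 0` (bounded `Φ`). -/
theorem tsum_coordGrad_colM_resp (ρ : Site (d + 1)) (j : ℕ) (α : Fin (d + 1)) (Φ : ℤ → ℝ) {B : ℝ} (hΦ : ∀ s, |Φ s| ≤ B) (μ : Fin (d + 1)) (y : Site (d + 1)) :
    ∑' w : Site (d + 1), (Φ (w α + 1) - Φ (w α)) * colM (coDressKBmAt ρ Lc (KInvStep (d := d) Lc j)) Lc μ y α w = 0 := by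
  have h := sum_tsum_coarseGrad_colM_resp (Lc := Lc) ρ j (fun w : Site (d + 1) => Φ (w α)) (fun w => hΦ (w α)) μ y
  rw [Finset.sum_eq_single α (fun ρ' _ hρ' => ?_) (fun h => absurd (Finset.mem_univ α) h)] at h
  · have e : ∀ w : Site (d + 1), Φ ((w + unitVec α) α) - Φ (w α) = Φ (w α + 1) - Φ (w α) := fun w => by
      simp only [Pi.add_apply, unitVec_apply, if_true]
    simp only [e] at h
    exact h
  · have e : ∀ w : Site (d + 1), Φ ((w + unitVec ρ') α) - Φ (w α) = 0 := fun w => by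
      simp only [Pi.add_apply, unitVec_apply, if_neg (Ne.symm hρ'), add_zero, sub_self]
    simp only [e, zero_mul, tsum_zero]

/-- NOT IN PRINT; OUR BOOKKEEPING.  Slab version in the response slot: `Σ'_w 𝟙[w_α = t]·colM G_j Lc μ y α w = 0`. -/
theorem tsum_slab_colM_resp (ρ : Site (d + 1)) (j : ℕ) (α : Fin (d + 1)) (t : ℤ) (μ : Fin (d + 1)) (y : Site (d + 1)) :
    ∑' w : Site (d + 1), (if w α = t then (1 : ℝ) else 0) * colM (coDressKBmAt ρ Lc (KInvStep (d := d) Lc j)) Lc μ y α w = 0 := by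
  have hΦ : ∀ s : ℤ, |(fun s : ℤ => if t < s then (1 : ℝ) else 0) s| ≤ 1 := fun s => by
    dsimp only; split_ifs <;> simp
  have h := tsum_coordGrad_colM_resp (Lc := Lc) ρ j α (fun s : ℤ => if t < s then (1 : ℝ) else 0) hΦ μ y
  have e : ∀ s : ℤ, ((if t < s + 1 then (1 : ℝ) else 0) - (if t < s then (1 : ℝ) else 0)) = if s = t then (1 : ℝ) else 0 := fun s => by
    by_cases h1 : s = t
    · subst h1; simp
    · by_cases h2 : t < s
      · rw [if_pos (by omega), if_pos h2, if_neg h1, sub_self]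
      · rw [if_neg (by omega), if_neg h2, if_neg h1, sub_self]
  simp only [e] at h
  exact h

/-- NOT IN PRINT; OUR BOOKKEEPING.  Bounded-weight version in the response slot: `Σ'_w f(w_α)·colM G_j Lc μ y α w = 0` (fibration over `w_α`). -/
theorem tsum_coord_colM_resp (ρ : Site (d + 1)) (j : ℕ) (α : Fin (d + 1)) (f : ℤ → ℝ) {B : ℝ} (hf : ∀ s, |f s| ≤ B) (μ : Fin (d + 1)) (y : Site (d + 1)) :
    ∑' w : Site (d + 1), f (w α) * colM (coDressKBmAt ρ Lc (KInvStep (d := d) Lc j)) Lc μ y α w = 0 := by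
  rw [tsum_coord_fibre _ (summable_resp_colM ρ j μ y α) α f hf]
  simp_rw [tsum_slab_colM_resp ρ j α _ μ y, mul_zero, tsum_zero]

/-- NOT IN PRINT; OUR BOOKKEEPING.  **ROW CHARGE, FIELD LEG** (every `j`, in-block root, bounded `f`): `Σ'_{x′} f(x′_α)·G_j (Lc•x′) y (inr α)(inl κ) = −cH_j·𝟙[κ = α ∧ y_α % Lc = Lc−1]·f((blk y)_α)`
(the coarse rows are MINUS the `ℋ`-columns, `coDressKBmAt_KInvStep_inr_inl_eq_neg_colH`; then my g41 `tsum_coord_colH`). -/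
theorem hasSum_row_coord_inl (hr : r ∈ box (d + 1) Lc) (j : ℕ) (α : Fin (d + 1)) (f : ℤ → ℝ) {B : ℝ} (hf : ∀ s, |f s| ≤ B)
    (y : Site (d + 1)) (κ : Fin (d + 1)) :
    HasSum (fun x' : Site (d + 1) => f (x' α) * coDressKBmAt (toSite r) Lc (KInvStep (d := d) Lc j) ((Lc : ℤ) • x') y (Sum.inr α) (Sum.inl κ))
      (-((stepScale d Lc j * (Lc : ℝ) ^ (d + 1))⁻¹ * (if κ = α ∧ y α % (Lc : ℤ) = (Lc : ℤ) - 1 then f (blk Lc y α) else 0))) := by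
  have hs : Summable fun x' : Site (d + 1) => f (x' α) * colH (coDressKBmAt (toSite r) Lc (KInvStep (d := d) Lc j)) Lc α x' κ y :=
    summable_bdd_mul (summable_source_colH r j α κ y) (fun x' => hf (x' α))
  have h1 : HasSum (fun x' : Site (d + 1) => f (x' α) * colH (coDressKBmAt (toSite r) Lc (KInvStep (d := d) Lc j)) Lc α x' κ y)
      ((stepScale d Lc j * (Lc : ℝ) ^ (d + 1))⁻¹ * (if κ = α ∧ y α % (Lc : ℤ) = (Lc : ℤ) - 1 then f (blk Lc y α) else 0)) := by
    rw [← tsum_coord_colH hr j α f hf κ y]; exact hs.hasSum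
  refine h1.neg.congr_fun fun x' => ?_
  rw [coDressKBmAt_KInvStep_inr_inl_eq_neg_colH]; ring

/-- NOT IN PRINT; OUR BOOKKEEPING.  **ROW CHARGE, MULTIPLIER LEG**: `Σ'_{x′} f(x′_α)·G_j (Lc•x′) y (inr α)(inr m) = 0` (coarse `y`: the response-slot law; off the coarse lattice every entry vanishes). -/
theorem hasSum_row_coord_inr (hr : r ∈ box (d + 1) Lc) (j : ℕ) (α : Fin (d + 1)) (f : ℤ → ℝ) {B : ℝ} (hf : ∀ s, |f s| ≤ B)
    (y : Site (d + 1)) (m : Fin (d + 1)) :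
    HasSum (fun x' : Site (d + 1) => f (x' α) * coDressKBmAt (toSite r) Lc (KInvStep (d := d) Lc j) ((Lc : ℤ) • x') y (Sum.inr α) (Sum.inr m)) 0 := by
  have _ := hr
  by_cases hy : Torus.proj Lc y = 0
  · have ey : y = ((Lc : ℕ) : ℤ) • quo Lc y := eq_zsmul_quo_of_proj hy
    have e : (fun x' : Site (d + 1) => f (x' α) * coDressKBmAt (toSite r) Lc (KInvStep (d := d) Lc j) ((Lc : ℤ) • x') y (Sum.inr α) (Sum.inr m))
        = fun x' => f (x' α) * colM (coDressKBmAt (toSite r) Lc (KInvStep (d := d) Lc j)) Lc m (quo Lc y) α x' := by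
      funext x'
      conv_lhs => rw [ey]
      rfl
    rw [e]
    have hs : Summable fun x' : Site (d + 1) => f (x' α) * colM (coDressKBmAt (toSite r) Lc (KInvStep (d := d) Lc j)) Lc m (quo Lc y) α x' :=
      summable_bdd_mul (summable_resp_colM (toSite r) j m (quo Lc y) α) (fun x' => hf (x' α))
    have h := hs.hasSum
    rwa [tsum_coord_colM_resp (toSite r) j α f hf m (quo Lc y)] at h
  · have e : (fun x' : Site (d + 1) => f (x' α) * coDressKBmAt (toSite r) Lc (KInvStep (d := d) Lc j) ((Lc : ℤ) • x') y (Sum.inr α) (Sum.inr m))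
        = fun _ => 0 := by
      funext x'
      rw [coDressKBmAt_inr_inr, KInvStep_inr_inr_off_right j hy _ α m, mul_zero]
    rw [e]
    exact hasSum_zero

/-- NOT IN PRINT; OUR BOOKKEEPING.  **COLUMN CHARGE, FIELD LEG**: `Σ'_{z′} G_j w (Lc•z′) (inl κ)(inr β)·f(z′_β) = cH_j·𝟙[κ = β ∧ w_β % Lc = Lc−1]·f((blk w)_β)` (my g41 `tsum_coord_colH`). -/
theorem hasSum_col_coord_inl (hr : r ∈ box (d + 1) Lc) (j : ℕ) (β : Fin (d + 1)) (f : ℤ → ℝ) {B : ℝ} (hf : ∀ s, |f s| ≤ B)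
    (w : Site (d + 1)) (κ : Fin (d + 1)) :
    HasSum (fun z' : Site (d + 1) => coDressKBmAt (toSite r) Lc (KInvStep (d := d) Lc j) w ((Lc : ℤ) • z') (Sum.inl κ) (Sum.inr β) * f (z' β))
      ((stepScale d Lc j * (Lc : ℝ) ^ (d + 1))⁻¹ * (if κ = β ∧ w β % (Lc : ℤ) = (Lc : ℤ) - 1 then f (blk Lc w β) else 0)) := by
  have hs : Summable fun z' : Site (d + 1) => f (z' β) * colH (coDressKBmAt (toSite r) Lc (KInvStep (d := d) Lc j)) Lc β z' κ w :=
    summable_bdd_mul (summable_source_colH r j β κ w) (fun z' => hf (z' β))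
  have h1 : HasSum (fun z' : Site (d + 1) => f (z' β) * colH (coDressKBmAt (toSite r) Lc (KInvStep (d := d) Lc j)) Lc β z' κ w)
      ((stepScale d Lc j * (Lc : ℝ) ^ (d + 1))⁻¹ * (if κ = β ∧ w β % (Lc : ℤ) = (Lc : ℤ) - 1 then f (blk Lc w β) else 0)) := by
    rw [← tsum_coord_colH hr j β f hf κ w]; exact hs.hasSum
  refine h1.congr_fun fun z' => ?_
  simp only [colH]; ring

/-- NOT IN PRINT; OUR BOOKKEEPING.  **COLUMN CHARGE, MULTIPLIER LEG**: `Σ'_{z′} G_j w (Lc•z′) (inr m)(inr β)·f(z′_β) = 0` (coarse `w`: my g41 `tsum_coord_colM`; off the coarse lattice: zero entries). -/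
theorem hasSum_col_coord_inr (hr : r ∈ box (d + 1) Lc) (j : ℕ) (β : Fin (d + 1)) (f : ℤ → ℝ) {B : ℝ} (hf : ∀ s, |f s| ≤ B)
    (w : Site (d + 1)) (m : Fin (d + 1)) :
    HasSum (fun z' : Site (d + 1) => coDressKBmAt (toSite r) Lc (KInvStep (d := d) Lc j) w ((Lc : ℤ) • z') (Sum.inr m) (Sum.inr β) * f (z' β)) 0 := by
  have _ := hr
  by_cases hw : Torus.proj Lc w = 0
  · have ew : w = ((Lc : ℕ) : ℤ) • quo Lc w := eq_zsmul_quo_of_proj hw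
    have e : (fun z' : Site (d + 1) => coDressKBmAt (toSite r) Lc (KInvStep (d := d) Lc j) w ((Lc : ℤ) • z') (Sum.inr m) (Sum.inr β) * f (z' β))
        = fun z' => f (z' β) * colM (coDressKBmAt (toSite r) Lc (KInvStep (d := d) Lc j)) Lc β z' m (quo Lc w) := by
      funext z'
      conv_lhs => rw [ew]
      rw [mul_comm]; rfl
    rw [e]
    have hs : Summable fun z' : Site (d + 1) => f (z' β) * colM (coDressKBmAt (toSite r) Lc (KInvStep (d := d) Lc j)) Lc β z' m (quo Lc w) :=
      summable_bdd_mul (summable_source_colM (toSite r) j β m (quo Lc w)) (fun z' => hf (z' β))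
    have h := hs.hasSum
    rwa [tsum_coord_colM (toSite r) j β f hf m (quo Lc w)] at h
  · have e : (fun z' : Site (d + 1) => coDressKBmAt (toSite r) Lc (KInvStep (d := d) Lc j) w ((Lc : ℤ) • z') (Sum.inr m) (Sum.inr β) * f (z' β))
        = fun _ => 0 := by
      funext z'
      rw [coDressKBmAt_inr_inr, KInvStep_inr_off j hw m _ _, zero_mul]
    rw [e]
    exact hasSum_zero

end Step

end Summit.QuantumFields.BalabanUV.Beta.GAN24.ChargeTowerLegs

end
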